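import Summits.HodgeConjecture.HodgeConjecture.Theses.ELineTransport

/-!
# Route `ELineTransport` — support item `ELineConnectivityR` (stmt-HodgeConjecture-13981), part 3:
# Schur's lemma for the Hodge structure of a period vector with `NS = 0`

For a period vector `x ∈ ℂ²²` of the K3 form `D = diag(1,1,1,-1,…,-1)` (`x·x = 0`, `x̄·x ≠ 0`)
the statement's "Hodge endomorphisms" are the rational matrices `A` with `A x ∈ ℂ x` which preserve
`H := {x, x̄}^⊥` (the `(1,1)`-part).  If moreover `NS(x) = x^⊥ ∩ ℚ²² = 0`, then (Schur):

* `eq_zero_of_mulVec_eq_zero` — `A x = 0` forces `A = 0` (each row of `A`, twisted by the signs of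
  `D`, is a rational vector orthogonal to `x`);
* `decomp` / `decomp_unique` — `ℂ²² = ℂx ⊕ ℂx̄ ⊕ H`;
* `isUnit_of_hodgeEnd` — a non-zero Hodge endomorphism is invertible, and
  `inv_hodgeEnd` — its inverse is again a Hodge endomorphism;
* `jm_hodgeEnd` — a `D`-self-adjoint rational `J` with `J x = r x` (`r` real) is a Hodge
  endomorphism.

Everything is written for the statement's complex form `qc v w = v ⬝ᵥ (D *ᵥ w)` verbatim.
No definitions, no named facts, no sorry.
-/

-- `Summit.HodgeConjecture.HodgeConjecture.…` (summit = problem) duplicates a namespace component by design (D-0017).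
set_option linter.dupNamespace false

noncomputable section

open Matrix Module

namespace Summit.HodgeConjecture.HodgeConjecture.Theorems

namespace ELineConnR

local notation3 "Dℂ" => (Matrix.diagonal (fun i : Fin 22 => if i.val < 3 then (1 : ℂ) else -1))

/-! ### The complex form: symmetry, conjugation, self-adjoint matrices -/

/-- Unfolding of the complex form. [folklore] -/
theorem qcx_apply (v w : Fin 22 → ℂ) :
    v ⬝ᵥ (Dℂ *ᵥ w) = ∑ i, (if i.val < 3 then (1 : ℂ) else -1) * v i * w i := by
  simp only [Matrix.mulVec_diagonal, dotProduct]
  exact Finset.sum_congr rfl fun i _ => by ring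

/-- The complex form is symmetric. [folklore] -/
theorem qcx_comm (v w : Fin 22 → ℂ) : v ⬝ᵥ (Dℂ *ᵥ w) = w ⬝ᵥ (Dℂ *ᵥ v) := by
  rw [qcx_apply, qcx_apply]
  exact Finset.sum_congr rfl fun i _ => by ring

/-- The complex form is `ℂ`-linear in the first variable (additivity). [folklore] -/
theorem qcx_add_left (v v' w : Fin 22 → ℂ) :
    (v + v') ⬝ᵥ (Dℂ *ᵥ w) = v ⬝ᵥ (Dℂ *ᵥ w) + v' ⬝ᵥ (Dℂ *ᵥ w) := by
  rw [add_dotProduct]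

/-- The complex form is `ℂ`-linear in the first variable (homogeneity). [folklore] -/
theorem qcx_smul_left (c : ℂ) (v w : Fin 22 → ℂ) :
    (c • v) ⬝ᵥ (Dℂ *ᵥ w) = c * (v ⬝ᵥ (Dℂ *ᵥ w)) := by
  rw [smul_dotProduct, smul_eq_mul]

/-- The complex form is `ℂ`-linear in the second variable (additivity). [folklore] -/
theorem qcx_add_right (v w w' : Fin 22 → ℂ) :
    v ⬝ᵥ (Dℂ *ᵥ (w + w')) = v ⬝ᵥ (Dℂ *ᵥ w) + v ⬝ᵥ (Dℂ *ᵥ w') := by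
  rw [Matrix.mulVec_add, dotProduct_add]

/-- The complex form is `ℂ`-linear in the second variable (homogeneity). [folklore] -/
theorem qcx_smul_right (c : ℂ) (v w : Fin 22 → ℂ) :
    v ⬝ᵥ (Dℂ *ᵥ (c • w)) = c * (v ⬝ᵥ (Dℂ *ᵥ w)) := by
  rw [Matrix.mulVec_smul, dotProduct_smul, smul_eq_mul]

/-- Conjugating both arguments conjugates the complex form. [folklore] -/
theorem qcx_star_star (v w : Fin 22 → ℂ) :
    (star v) ⬝ᵥ (Dℂ *ᵥ (star w)) = star (v ⬝ᵥ (Dℂ *ᵥ w)) := by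
  rw [qcx_apply, qcx_apply, star_sum]
  refine Finset.sum_congr rfl fun i _ => ?_
  simp only [Pi.star_apply, star_mul', mul_assoc]
  congr 1
  split_ifs <;> simp

/-- A rational matrix commutes with complex conjugation of vectors. [folklore] -/
theorem star_ratMap_mulVec (A : Matrix (Fin 22) (Fin 22) ℚ) (v : Fin 22 → ℂ) :
    star ((A.map (fun t : ℚ => (t : ℂ))) *ᵥ v) = (A.map (fun t : ℚ => (t : ℂ))) *ᵥ (star v) := by
  funext i
  simp only [Pi.star_apply, Matrix.mulVec, dotProduct, Matrix.map_apply, star_sum, star_mul',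
    Complex.star_def, map_ratCast]

/-- Entrywise coercion `ℚ → ℂ` of matrices is multiplicative. [folklore] -/
theorem ratMap_mul (M N : Matrix (Fin 22) (Fin 22) ℚ) :
    (M * N).map (fun t : ℚ => (t : ℂ)) = M.map (fun t : ℚ => (t : ℂ)) * N.map (fun t : ℚ => (t : ℂ)) := by
  have h := Matrix.map_mul (L := M) (M := N) (f := Rat.castHom ℂ)
  simpa only [Rat.coe_castHom] using h

/-- Entrywise coercion `ℚ → ℂ` of the identity matrix. [folklore] -/
theorem ratMap_one : (1 : Matrix (Fin 22) (Fin 22) ℚ).map (fun t : ℚ => (t : ℂ)) = 1 := by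
  exact Matrix.map_one _ (by simp) (by simp)

/-- A `D`-self-adjoint rational matrix is self-adjoint for the complex form. [folklore] -/
theorem qcx_mulVec_selfAdjoint (J : Matrix (Fin 22) (Fin 22) ℚ)
    (hJ : J.transpose * Matrix.diagonal (fun i : Fin 22 => if i.val < 3 then (1 : ℚ) else -1) =
      Matrix.diagonal (fun i : Fin 22 => if i.val < 3 then (1 : ℚ) else -1) * J)
    (v w : Fin 22 → ℂ) :
    ((J.map (fun t : ℚ => (t : ℂ))) *ᵥ v) ⬝ᵥ (Dℂ *ᵥ w) =
      v ⬝ᵥ (Dℂ *ᵥ ((J.map (fun t : ℚ => (t : ℂ))) *ᵥ w)) := by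
  have hD : (Matrix.diagonal (fun i : Fin 22 => if i.val < 3 then (1 : ℚ) else -1)).map
      (fun t : ℚ => (t : ℂ)) = Dℂ := by
    rw [Matrix.diagonal_map (by simp)]
    congr 1
    funext i
    split_ifs <;> simp
  have hJc : (J.map (fun t : ℚ => (t : ℂ))).transpose * Dℂ = Dℂ * J.map (fun t : ℚ => (t : ℂ)) := by
    have h := congrArg (fun M : Matrix (Fin 22) (Fin 22) ℚ => M.map (fun t : ℚ => (t : ℂ))) hJ
    simp only [ratMap_mul, Matrix.transpose_map, hD] at h
    exact h
  rw [dotProduct_comm, Matrix.dotProduct_mulVec, ← Matrix.mulVec_transpose, Matrix.mulVec_mulVec,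
    hJc, ← Matrix.mulVec_mulVec, dotProduct_comm]

/-! ### `NS(x) = 0`: an endomorphism killing `x` is zero -/

/-- **`A x = 0 ⇒ A = 0` when `NS(x) = 0`.** Each row of `A`, multiplied by the signs of `D`, is a
rational vector `qc`-orthogonal to `x`. [folklore] -/
theorem eq_zero_of_mulVec_eq_zero {x : Fin 22 → ℂ}
    (hNS : ∀ l : Fin 22 → ℚ, (fun j => (l j : ℂ)) ⬝ᵥ (Dℂ *ᵥ x) = 0 → l = 0)
    {A : Matrix (Fin 22) (Fin 22) ℚ} (hA : (A.map (fun t : ℚ => (t : ℂ))) *ᵥ x = 0) : A = 0 := by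
  ext i j
  -- the twisted row `l_j = d_j A i j`
  set l : Fin 22 → ℚ := fun j => (if j.val < 3 then (1 : ℚ) else -1) * A i j with hl
  have hrow : (fun j => (l j : ℂ)) ⬝ᵥ (Dℂ *ᵥ x) = ((A.map (fun t : ℚ => (t : ℂ))) *ᵥ x) i := by
    rw [qcx_apply]
    simp only [Matrix.mulVec, dotProduct, Matrix.map_apply, hl]
    refine Finset.sum_congr rfl fun j _ => ?_
    split_ifs <;> push_cast <;> ring
  rw [hA] at hrow
  have hl0 := hNS l hrow
  have := congrFun hl0 j
  simp only [hl, Pi.zero_apply, mul_eq_zero] at this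
  rcases this with h | h
  · split_ifs at h <;> norm_num at h
  · simpa using h

/-! ### The decomposition `ℂ²² = ℂx ⊕ ℂx̄ ⊕ {x, x̄}^⊥` -/

/-- Explicit decomposition of any vector along `x`, `x̄` and `H = {x, x̄}^⊥`, for a period vector
(`x·x = 0`, `x̄·x ≠ 0`). [folklore] -/
theorem decomp {x : Fin 22 → ℂ} (hxx : x ⬝ᵥ (Dℂ *ᵥ x) = 0) (hxb : (star x) ⬝ᵥ (Dℂ *ᵥ x) ≠ 0)
    (z : Fin 22 → ℂ) :
    ∃ (α β : ℂ) (h : Fin 22 → ℂ), h ⬝ᵥ (Dℂ *ᵥ x) = 0 ∧ h ⬝ᵥ (Dℂ *ᵥ (star x)) = 0 ∧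
      z = α • x + β • star x + h := by
  have hbx : x ⬝ᵥ (Dℂ *ᵥ star x) ≠ 0 := by rwa [qcx_comm]
  have hbb : (star x) ⬝ᵥ (Dℂ *ᵥ star x) = 0 := by
    rw [qcx_star_star, hxx, star_zero]
  refine ⟨(z ⬝ᵥ (Dℂ *ᵥ star x)) / (x ⬝ᵥ (Dℂ *ᵥ star x)),
    (z ⬝ᵥ (Dℂ *ᵥ x)) / ((star x) ⬝ᵥ (Dℂ *ᵥ x)),
    z - ((z ⬝ᵥ (Dℂ *ᵥ star x)) / (x ⬝ᵥ (Dℂ *ᵥ star x))) • x -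
      ((z ⬝ᵥ (Dℂ *ᵥ x)) / ((star x) ⬝ᵥ (Dℂ *ᵥ x))) • star x, ?_, ?_, ?_⟩
  · rw [sub_dotProduct, sub_dotProduct, qcx_smul_left, qcx_smul_left, hxx, mul_zero, sub_zero,
      div_mul_cancel₀ _ hxb, sub_self]
  · rw [sub_dotProduct, sub_dotProduct, qcx_smul_left, qcx_smul_left, hbb, mul_zero, sub_zero,
      div_mul_cancel₀ _ hbx, sub_self]
  · abel

/-- Directness of the decomposition: `α x + β x̄ + h = 0` with `h ∈ H` forces
`α = β = 0`, `h = 0`. [folklore] -/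
theorem decomp_unique {x : Fin 22 → ℂ} (hxx : x ⬝ᵥ (Dℂ *ᵥ x) = 0)
    (hxb : (star x) ⬝ᵥ (Dℂ *ᵥ x) ≠ 0) {α β : ℂ} {h : Fin 22 → ℂ}
    (h1 : h ⬝ᵥ (Dℂ *ᵥ x) = 0) (h2 : h ⬝ᵥ (Dℂ *ᵥ (star x)) = 0)
    (h0 : α • x + β • star x + h = 0) : α = 0 ∧ β = 0 ∧ h = 0 := by
  have hbx : x ⬝ᵥ (Dℂ *ᵥ star x) ≠ 0 := by rwa [qcx_comm]
  have hbb : (star x) ⬝ᵥ (Dℂ *ᵥ star x) = 0 := by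
    rw [qcx_star_star, hxx, star_zero]
  have ex := congrArg (fun z => z ⬝ᵥ (Dℂ *ᵥ x)) h0
  have eb := congrArg (fun z => z ⬝ᵥ (Dℂ *ᵥ star x)) h0
  simp only [add_dotProduct, zero_dotProduct] at ex eb
  rw [qcx_smul_left, qcx_smul_left] at ex eb
  rw [hxx, h1, mul_zero, zero_add, add_zero] at ex
  rw [hbb, h2, mul_zero, add_zero, add_zero] at eb
  have hβ : β = 0 := by
    rcases mul_eq_zero.1 ex with h | h
    · exact h
    · exact absurd h hxb
  have hα : α = 0 := by
    rcases mul_eq_zero.1 eb with h | h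
    · exact h
    · exact absurd h hbx
  refine ⟨hα, hβ, ?_⟩
  rw [hα, hβ, zero_smul, zero_smul, zero_add, zero_add] at h0
  exact h0

/-! ### Schur: non-zero Hodge endomorphisms are invertible, with Hodge inverse -/

/-- The eigenvalue on `x̄` is the conjugate eigenvalue. [folklore] -/
theorem mulVec_star_of_mulVec {x : Fin 22 → ℂ} {A : Matrix (Fin 22) (Fin 22) ℚ} {c : ℂ}
    (hA : (A.map (fun t : ℚ => (t : ℂ))) *ᵥ x = c • x) :
    (A.map (fun t : ℚ => (t : ℂ))) *ᵥ (star x) = (star c) • star x := by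
  rw [← star_ratMap_mulVec, hA, star_smul]

/-- **Schur's lemma, kernel form.** For a period vector `x` with `NS(x) = 0`, a Hodge endomorphism
`A ≠ 0` (eigenvector `x`, preserving `H = {x, x̄}^⊥`) kills no non-zero rational vector.
[folklore] -/
theorem mulVec_rat_eq_zero {x : Fin 22 → ℂ} (hxx : x ⬝ᵥ (Dℂ *ᵥ x) = 0)
    (hxb : (star x) ⬝ᵥ (Dℂ *ᵥ x) ≠ 0)
    (hNS : ∀ l : Fin 22 → ℚ, (fun j => (l j : ℂ)) ⬝ᵥ (Dℂ *ᵥ x) = 0 → l = 0)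
    {A : Matrix (Fin 22) (Fin 22) ℚ} (hA0 : A ≠ 0) {c : ℂ}
    (hAx : (A.map (fun t : ℚ => (t : ℂ))) *ᵥ x = c • x)
    (hAH : ∀ v : Fin 22 → ℂ, v ⬝ᵥ (Dℂ *ᵥ x) = 0 → v ⬝ᵥ (Dℂ *ᵥ (star x)) = 0 →
      ((A.map (fun t : ℚ => (t : ℂ))) *ᵥ v) ⬝ᵥ (Dℂ *ᵥ x) = 0 ∧
      ((A.map (fun t : ℚ => (t : ℂ))) *ᵥ v) ⬝ᵥ (Dℂ *ᵥ (star x)) = 0)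
    {w : Fin 22 → ℚ} (hw : A *ᵥ w = 0) : w = 0 := by
  -- the eigenvalue is non-zero
  have hc : c ≠ 0 := by
    intro hc
    rw [hc, zero_smul] at hAx
    exact hA0 (eq_zero_of_mulVec_eq_zero hNS hAx)
  -- decompose `w` and apply `A`
  obtain ⟨α, β, h, h1, h2, hdec⟩ := decomp hxx hxb (fun j => (w j : ℂ))
  have hAw : (A.map (fun t : ℚ => (t : ℂ))) *ᵥ (fun j => (w j : ℂ)) = 0 := by
    have : (fun j => (w j : ℂ)) = fun j => ((w j : ℚ) : ℂ) := rfl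
    funext i
    have hi := congrFun hw i
    simp only [Matrix.mulVec, dotProduct, Pi.zero_apply] at hi ⊢
    simp only [Matrix.map_apply]
    have : ∑ j, ((A i j : ℚ) : ℂ) * (w j : ℂ) = ((∑ j, A i j * w j : ℚ) : ℂ) := by push_cast; rfl
    rw [this, hi]
    simp
  rw [hdec, Matrix.mulVec_add, Matrix.mulVec_add, Matrix.mulVec_smul, Matrix.mulVec_smul, hAx,
    mulVec_star_of_mulVec hAx, smul_smul, smul_smul] at hAw
  obtain ⟨hAh1, hAh2⟩ := hAH h h1 h2
  obtain ⟨hα, hβ, -⟩ := decomp_unique hxx hxb hAh1 hAh2 hAw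
  have hα' : α = 0 := by
    rcases mul_eq_zero.1 hα with h | h
    · exact h
    · exact absurd h hc
  have hβ' : β = 0 := by
    rcases mul_eq_zero.1 hβ with h | h
    · exact h
    · exact absurd h (star_ne_zero.2 hc)
  rw [hα', hβ', zero_smul, zero_smul, zero_add, zero_add] at hdec
  -- so `w ∈ H`, hence `qc w x = 0`, hence `w = 0`
  apply hNS w
  rw [hdec]
  exact h1

/-- **Schur's lemma.** For a period vector `x` with `NS(x) = 0`, a non-zero Hodge endomorphism is
an invertible rational matrix. [folklore] -/
theorem isUnit_of_hodgeEnd {x : Fin 22 → ℂ} (hxx : x ⬝ᵥ (Dℂ *ᵥ x) = 0)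
    (hxb : (star x) ⬝ᵥ (Dℂ *ᵥ x) ≠ 0)
    (hNS : ∀ l : Fin 22 → ℚ, (fun j => (l j : ℂ)) ⬝ᵥ (Dℂ *ᵥ x) = 0 → l = 0)
    {A : Matrix (Fin 22) (Fin 22) ℚ} (hA0 : A ≠ 0) {c : ℂ}
    (hAx : (A.map (fun t : ℚ => (t : ℂ))) *ᵥ x = c • x)
    (hAH : ∀ v : Fin 22 → ℂ, v ⬝ᵥ (Dℂ *ᵥ x) = 0 → v ⬝ᵥ (Dℂ *ᵥ (star x)) = 0 →
      ((A.map (fun t : ℚ => (t : ℂ))) *ᵥ v) ⬝ᵥ (Dℂ *ᵥ x) = 0 ∧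
      ((A.map (fun t : ℚ => (t : ℂ))) *ᵥ v) ⬝ᵥ (Dℂ *ᵥ (star x)) = 0) :
    IsUnit A := by
  rw [Matrix.isUnit_iff_isUnit_det, isUnit_iff_ne_zero]
  intro hdet
  obtain ⟨w, hw0, hw⟩ := Matrix.exists_mulVec_eq_zero_iff.2 hdet
  exact hw0 (mulVec_rat_eq_zero hxx hxb hNS hA0 hAx hAH hw)

/-- **The inverse of an invertible Hodge endomorphism is a Hodge endomorphism** (eigenvalue
`c⁻¹` on `x`, preserves `H`). [folklore] -/
theorem inv_hodgeEnd {x : Fin 22 → ℂ} (hxx : x ⬝ᵥ (Dℂ *ᵥ x) = 0)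
    (hxb : (star x) ⬝ᵥ (Dℂ *ᵥ x) ≠ 0)
    (hNS : ∀ l : Fin 22 → ℚ, (fun j => (l j : ℂ)) ⬝ᵥ (Dℂ *ᵥ x) = 0 → l = 0)
    {A : Matrix (Fin 22) (Fin 22) ℚ} (hA : IsUnit A) {c : ℂ}
    (hAx : (A.map (fun t : ℚ => (t : ℂ))) *ᵥ x = c • x)
    (hAH : ∀ v : Fin 22 → ℂ, v ⬝ᵥ (Dℂ *ᵥ x) = 0 → v ⬝ᵥ (Dℂ *ᵥ (star x)) = 0 →
      ((A.map (fun t : ℚ => (t : ℂ))) *ᵥ v) ⬝ᵥ (Dℂ *ᵥ x) = 0 ∧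
      ((A.map (fun t : ℚ => (t : ℂ))) *ᵥ v) ⬝ᵥ (Dℂ *ᵥ (star x)) = 0) :
    (∃ c' : ℂ, (A⁻¹.map (fun t : ℚ => (t : ℂ))) *ᵥ x = c' • x) ∧
    (∀ v : Fin 22 → ℂ, v ⬝ᵥ (Dℂ *ᵥ x) = 0 → v ⬝ᵥ (Dℂ *ᵥ (star x)) = 0 →
      ((A⁻¹.map (fun t : ℚ => (t : ℂ))) *ᵥ v) ⬝ᵥ (Dℂ *ᵥ x) = 0 ∧
      ((A⁻¹.map (fun t : ℚ => (t : ℂ))) *ᵥ v) ⬝ᵥ (Dℂ *ᵥ (star x)) = 0) := by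
  have hx0 : x ≠ 0 := by
    intro h; apply hxb; rw [h]; simp
  -- `A⁻¹ A = 1` over `ℂ`
  have hinv : A⁻¹.map (fun t : ℚ => (t : ℂ)) * A.map (fun t : ℚ => (t : ℂ)) = 1 := by
    rw [← ratMap_mul, Matrix.nonsing_inv_mul _ ((Matrix.isUnit_iff_isUnit_det _).1 hA), ratMap_one]
  have hc : c ≠ 0 := by
    intro hc
    rw [hc, zero_smul] at hAx
    have hA0 : A ≠ 0 := by
      intro h0
      rw [h0] at hA
      exact (not_isUnit_zero) hA
    exact hA0 (eq_zero_of_mulVec_eq_zero hNS hAx)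
  -- eigenvalue `c⁻¹`
  have hAix : (A⁻¹.map (fun t : ℚ => (t : ℂ))) *ᵥ x = c⁻¹ • x := by
    have h := congrArg (fun z => (A⁻¹.map (fun t : ℚ => (t : ℂ))) *ᵥ z) hAx
    simp only [Matrix.mulVec_mulVec, hinv, Matrix.one_mulVec, Matrix.mulVec_smul] at h
    rw [eq_inv_smul_iff₀ hc]
    exact h.symm
  refine ⟨⟨c⁻¹, hAix⟩, ?_⟩
  intro v hv1 hv2
  set w := (A⁻¹.map (fun t : ℚ => (t : ℂ))) *ᵥ v with hw
  obtain ⟨α, β, h, h1, h2, hdec⟩ := decomp hxx hxb w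
  -- apply `A`: `v = αc x + β c̄ x̄ + A h`
  have hAw : (A.map (fun t : ℚ => (t : ℂ))) *ᵥ w = v := by
    rw [hw, Matrix.mulVec_mulVec, ← ratMap_mul,
      Matrix.mul_nonsing_inv _ ((Matrix.isUnit_iff_isUnit_det _).1 hA), ratMap_one, Matrix.one_mulVec]
  rw [hdec, Matrix.mulVec_add, Matrix.mulVec_add, Matrix.mulVec_smul, Matrix.mulVec_smul, hAx,
    mulVec_star_of_mulVec hAx, smul_smul, smul_smul] at hAw
  obtain ⟨hAh1, hAh2⟩ := hAH h h1 h2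
  -- `v - A h ∈ H` equals `αc x + β c̄ x̄`
  have hzero : (α * c) • x + (β * star c) • star x +
      ((A.map (fun t : ℚ => (t : ℂ))) *ᵥ h - v) = 0 := by
    rw [← hAw]; abel
  have hd1 : ((A.map (fun t : ℚ => (t : ℂ))) *ᵥ h - v) ⬝ᵥ (Dℂ *ᵥ x) = 0 := by
    rw [sub_dotProduct, hAh1, hv1, sub_zero]
  have hd2 : ((A.map (fun t : ℚ => (t : ℂ))) *ᵥ h - v) ⬝ᵥ (Dℂ *ᵥ star x) = 0 := by
    rw [sub_dotProduct, hAh2, hv2, sub_zero]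
  obtain ⟨hα, hβ, -⟩ := decomp_unique hxx hxb hd1 hd2 hzero
  have hα' : α = 0 := by
    rcases mul_eq_zero.1 hα with h | h
    · exact h
    · exact absurd h hc
  have hβ' : β = 0 := by
    rcases mul_eq_zero.1 hβ with h | h
    · exact h
    · exact absurd h (star_ne_zero.2 hc)
  rw [hα', hβ', zero_smul, zero_smul, zero_add, zero_add] at hdec
  rw [hdec]
  exact ⟨h1, h2⟩

/-- **`J` is a Hodge endomorphism**: a `D`-self-adjoint rational matrix with `J x = r x`, `r`
real, preserves `H = {x, x̄}^⊥`. [folklore] -/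
theorem jm_hodgeEnd {x : Fin 22 → ℂ} (J : Matrix (Fin 22) (Fin 22) ℚ)
    (hJ : J.transpose * Matrix.diagonal (fun i : Fin 22 => if i.val < 3 then (1 : ℚ) else -1) =
      Matrix.diagonal (fun i : Fin 22 => if i.val < 3 then (1 : ℚ) else -1) * J)
    (r : ℝ) (hJx : (J.map (fun t : ℚ => (t : ℂ))) *ᵥ x = (r : ℂ) • x)
    (v : Fin 22 → ℂ) (hv1 : v ⬝ᵥ (Dℂ *ᵥ x) = 0) (hv2 : v ⬝ᵥ (Dℂ *ᵥ (star x)) = 0) :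
    ((J.map (fun t : ℚ => (t : ℂ))) *ᵥ v) ⬝ᵥ (Dℂ *ᵥ x) = 0 ∧
    ((J.map (fun t : ℚ => (t : ℂ))) *ᵥ v) ⬝ᵥ (Dℂ *ᵥ (star x)) = 0 := by
  have hJb : (J.map (fun t : ℚ => (t : ℂ))) *ᵥ (star x) = (r : ℂ) • star x := by
    rw [mulVec_star_of_mulVec hJx, Complex.star_def, Complex.conj_ofReal]
  constructor
  · rw [qcx_mulVec_selfAdjoint J hJ, hJx, qcx_smul_right, hv1, mul_zero]
  · rw [qcx_mulVec_selfAdjoint J hJ, hJb, qcx_smul_right, hv2, mul_zero]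

end ELineConnR

end Summit.HodgeConjecture.HodgeConjecture.Theorems

end
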